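import Summits.PneNP.PneNP.Theses.NoTardosTropics

/-!
# `Assembly` (route NoTardosTropics, item stmt-PneNP-10506)

Route `Summits/PneNP/PneNP/Theses/NoTardosTropics.lean`, item stmt-PneNP-10506 (`Assembly`, rank 1):

  `XAdd → FKThm3Digital → MPGRealMemNDPadd → OracleRemoval → PneNP`.

This is, verbatim, the telescope of the route's kernel-checked deciding theorem
`Summit.PneNP.PneNP.Theses.NoTardosTropics.closes` (route file rev 2, D-0027 §2.1), whose proof is
pure logic over the four items: `¬ PneNP` gives `NP_w0 Bool ⊆ P_w0 Bool`, hence (by the proved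
bridges `Literature.Computability.Complexity.P_bool_eq_holds` and
`Literature.Computability.Complexity.NP_subset_NP_bool`, used inside that proof, never as
hypotheses) `Nondeterministic.NP ⊆ Classes.P`; `FKThm3Digital` at `L = MPG_ℝ` (antecedent supplied
by `MPGRealMemNDPadd`) yields a Boolean `A ∈ NP` with `MPG_ℝ ∈ P⁰_add^A`; then `A ∈ P`,
`OracleRemoval` strips the oracle, contradicting `XAdd`. So the item closes by `exact closes`.

References: H. Fournier, P. Koiran, *Lower bounds are not easier over the reals: inside PH*
(ICALP 2000), Thm 3 p.10 with Fact 2 (the transfer `NP⁰_Rovs ⊆ P⁰_Rovs(NP)`).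
-/

set_option linter.dupNamespace false -- `Summit.PneNP.PneNP.…`: summit = sub-problem name (D-0017 single-conjunct layout)

namespace Summit.PneNP.PneNP.Theorems

/-- **Assembly of route NoTardosTropics** (item stmt-PneNP-10506):
`XAdd → FKThm3Digital → MPGRealMemNDPadd → OracleRemoval → PneNP`. If `P = NP` then the Boolean
`NP` oracle that the Fournier–Koiran transfer (`FKThm3Digital`, applied to the `NDP⁰_add`
verifier `MPGRealMemNDPadd` of real mean payoff) attaches to a poly-time sign-query algorithm for
`MPG_ℝ` lies in `P` and is removable (`OracleRemoval`), contradicting `XAdd`; proved through the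
route's deciding theorem `closes`, which has exactly this telescope. [FournierKoiran2000, Thm 3] -/
theorem noTardosTropics_assembly_proof :
    Summit.PneNP.PneNP.Theses.NoTardosTropics.Assembly := by
  unfold Summit.PneNP.PneNP.Theses.NoTardosTropics.Assembly
  exact Summit.PneNP.PneNP.Theses.NoTardosTropics.closes

end Summit.PneNP.PneNP.Theorems
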